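import Literature.AlgebraicGeometry.Milne1999.LefschetzGroupProductsPowers
import Literature.AlgebraicGeometry.Milne1999.LefschetzGroupTorusFiniteProducts
import HarnessLib

/-!
# `(L(X × ∏ᵢ Aᵢ^{rᵢ+1}), l) ≅ (L(X × ∏ᵢ Aᵢ), l)` and `(L(∏ᵢ Aᵢ^{rᵢ+1}), l) ≅ (L(∏ᵢ Aᵢ), l)` for ARBITRARY finite families of complex abelian varieties: all exponents reduce to `1` (Milne 1999, §1 p. 643, Prop. 1.5, Cor. 4.7; Moonen–Zarhin 1999, §1 «`Hg(X₁^{n₁} × ⋯ × X_r^{n_r}) = Hg(X₁ × ⋯ × X_r)`» for Milne's `L` and `ker l`, every `r` — Tannaka-free, on the family carriers)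

Family `hodge`, layer `Literature/AlgebraicGeometry/Milne1999`, namespace `Literature.AlgebraicGeometry.Milne1999` (D-0022).
THEOREMS ONLY (no definition, no named fact, no `sorry`; net debt 0). Sequel of `Milne1999/LefschetzGroupProductsPowers` (two
factors: `(L(B × C), l) ≅ (L(B^{m+1} × C^{n+1}), l)` for arbitrary `B`, `C`) and `Milne1999/LefschetzGroupTorusFiniteProducts` (isogeny
invariance of `(L, l)`: `exists_lefschetzGroup_mulEquiv_of_isIsogeny`), written by the `lit-hodgefound` prover seat p21 (generation 35,
row #5) to close what `HodgeGroupProductsPowers` / `LefschetzGroupProductsPowers` list under "What is NOT here": THREE OR MORE FACTORS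
WITH UNEQUAL EXPONENTS, for Milne's Lefschetz group with its character. No hypothesis on the factors (`Hom(Aᵢ, Aⱼ)` arbitrary, any
dimensions, an arbitrary «passenger» factor `X`).

## Sources, verbatim (held texts, re-read for this file)

* B. Moonen, Yu. G. Zarhin, *Hodge classes on abelian varieties of low dimension*, Math. Ann. 315 (1999) [held:
  `paper:arxiv-math_9901113`, chunk p0002 L137–L141], §1: «For `n ≥ 1` we can identify `Hg(Xⁿ)` with `Hg(X)`, acting diagonally on
  `V_{Xⁿ} = (V_X)ⁿ`. More generally, if `n_1, …, n_r ∈ ℤ_{≥1}` then we can identify `Hg(X_1^{n_1} × ⋯ × X_r^{n_r})` with `Hg(X_1 × ⋯ × X_r)`.»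
* J. S. Milne, *Lefschetz classes on abelian varieties*, Duke Math. J. 96 (1999) [held: `paper:doi-10-1215-s0012-7094-99-09620-5`,
  p0005 L12–L16, p0006 L24–L28, p0021 L42–L44]: §1 p. 643 «the diagonal action of `C(A)` on `rV(A)` identifies `C(A)` with `C(A^r)`»,
  «`C(A) ⊂ C(A_1) × ⋯ × C(A_s)`»; Prop. 1.5 «an isogeny `A_1^{r_1} × ⋯ × A_s^{r_s} → A` […] induces an isomorphism
  `S(A_1) × ⋯ × S(A_s) → S(A)`»; Cor. 4.7 «An isogeny `A → A_1^{r_1} × ⋯ × A_s^{r_s}` with the `A_i` simple and pairwise nonisogenous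
  defines an isomorphism `(L(A), l(A)) → ∏ (L(A_i), l(A_i))`».

## The objects (all pre-existing in the tree; nothing is defined here)

`L(Y)(ℂ) = lefschetzGroup (dim Y) Y.X`, `ker l(Y)(ℂ) = specialLefschetzGroup (dim Y) Y.X` (`Milne1999/LefschetzGroup`, Tannaka-free
families on `⊕ₖ Hᵏ(Y(ℂ); ℂ)`), the weight cocharacter `w(c) = weightCocharacter Y.X c`; `Y^{r+1} = Y.powSucc r`, `×` = `AbelianVariety.prod`,
`⨁` the finite biproduct of `AbelianVariety ℂ` with its comparison isogenies `biproductSuccSplit A : ⨁ A ⟶ A₀ × ⨁ᵢ A_{i+1}` /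
`biproductSuccSplitInv` (`Milne1999/LefschetzCentraliserBiproducts`). As in the two prequels THE CHARACTER `l` is carried CLASS-FREE by the
pair («`g ∈ ker l`», «`w(c) ↦ w(c)`»): every isomorphism below matches the kernels of `l` and the weight cocharacters, hence `l`
(`L = w(𝔾_m) · ker l`, `l ∘ w = 2`).

## What is proved

* §1 **PASSENGER FORM** `exists_lefschetzGroup_prod_biproduct_mulEquiv_prod_biproduct_powSucc`: for every `X`, every finite family
  `A : Fin n → AbelianVariety ℂ` and exponents `r`, an isomorphism `L(X × ⨁ᵢ Aᵢ)(ℂ) ≃* L(X × ⨁ᵢ Aᵢ^{rᵢ+1})(ℂ)` with `ker l ↔ ker l` and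
  `w ↦ w`. Induction on `n` along `X × ⨁ A ∼ X × (A₀ × ⨁ A_{i+1}) ∼ (X × ⨁ A_{i+1}) × A₀` (isogenies: `biproductSuccSplit`, reassociation),
  the two-factor theorem of the prequel with `m = 0` (`(X × ⨁ A_{i+1}) × A₀ ↦ (X × ⨁ A_{i+1}) × A₀^{r₀+1}`), `∼ (X × A₀^{r₀+1}) × ⨁ A_{i+1}`,
  the induction hypothesis WITH PASSENGER `X × A₀^{r₀+1}`, and back (`biproductSuccSplitInv`); isogenies act by
  `exists_lefschetzGroup_mulEquiv_of_isIsogeny`.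
* §2 **`(L(⨁ᵢ Aᵢ), l) ≅ (L(⨁ᵢ Aᵢ^{rᵢ+1}), l)`** (`exists_lefschetzGroup_biproduct_mulEquiv_biproduct_powSucc`, families on `Fin (n+1)`), the
  `ker l` isomorphism (`exists_specialLefschetzGroup_biproduct_mulEquiv_biproduct_powSucc`), **`(L(A), l) ≅ (L(A^{r+1}), l)` with NO
  dimension hypothesis** (`exists_lefschetzGroup_powSucc_mulEquiv'`; the lane's `exists_lefschetzGroup_powSucc_mulEquiv` has `dim A ≥ 1` and the
  explicit `g₁ ↦ g₁^{⊕(r+1)}`), and the transport of torus coordinates with character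
  (`exists_lefschetzGroup_biproduct_powSucc_mulEquiv_of_mulEquiv_biproduct`, the `H1 ∧ H2` format of `LefschetzGroupTorusFiniteProducts`:
  last coordinate `= 1` on `ker l`, `= c²` at `w(c)`), plus the same for every `Y ∼ ⨁ᵢ Aᵢ^{rᵢ+1}`, `Z ∼ ⨁ᵢ Aᵢ`
  (`exists_lefschetzGroup_mulEquiv_of_isIsogenous_biproduct_powSucc_of_isIsogenous_biproduct`), and «`L(⨁ᵢ Aᵢ^{rᵢ+1})` commutative iff
  `L(⨁ᵢ Aᵢ)` commutative» (`forall_mul_comm_lefschetzGroup_biproduct_powSucc_iff`).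
* §3 **THREE FACTORS, BIPRODUCT-FREE**: `(L((A × B) × C), l) ≅ (L((A^{a+1} × B^{b+1}) × C^{c+1}), l)` for arbitrary `A`, `B`, `C`
  (`exists_lefschetzGroup_prod_prod_mulEquiv_powSucc_prod_powSucc_prod_powSucc`; `Nonempty` forms for `L` and `ker l`).

## What is NOT here (honest column)

The explicit `H¹`-formula of the isomorphisms (block-diagonal with diagonal blocks — available factor by factor from the prequel's
`exists_lefschetzGroup_prod_mulEquiv_powSucc_prod_powSucc`, not threaded through the reassociations here); the group `L(⨁ᵢ Aᵢ)` itself for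
non-orthogonal families (only the REDUCTION of exponents is proved; for pairwise `Hom`-orthogonal factors see
`LefschetzGroupTorusFiniteProducts`); Milne's algebraic groups and the Tannakian `(L, l)`; the `Hg` / `MT` analogues for `r ≥ 3` factors
(same bookkeeping over `HodgeGroupPowersProductsMulEquiv`). PRESEARCH (2026-08-28): corpus `paper:arxiv-math_9901113` §1 and
`paper:doi-10-1215-s0012-7094-99-09620-5` pp. 643–644, 660 re-read (quotes above); tree: `rg 'biproduct_powSucc|powSucc_prod_powSucc'` —
`HodgeGroupProductsPowers` / `LefschetzGroupProductsPowers` (two factors), `LefschetzGroupTorusFiniteProducts` (finite products, `Hom`-orthogonal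
only), `HodgeTheory/FiniteProductsMixedPowersRetract` (retractions, class side); no statement for `L` of a general finite product of powers;
certification on the carriers, no novelty claimed.

## References

* [Milne1999LefschetzClasses] J. S. Milne, Lefschetz classes on abelian varieties, Duke Math. J. 96 (1999) 639–675: §1 p. 643,
  Prop. 1.5 (p. 644), Def. 4.3 and p. 659, Cor. 4.7 (p. 660).
* [MoonenZarhin1999LowDim] B. Moonen, Yu. G. Zarhin, Hodge classes on abelian varieties of low dimension, Math. Ann. 315 (1999)
  711–733: §1.
* [MumfordAV1970] D. Mumford, Abelian Varieties (1970): §19 (products, isogenies).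
-/

noncomputable section

open CategoryTheory CategoryTheory.Limits
open Literature.AlgebraicTopology.SingularHomology
open Literature.AlgebraicGeometry.HodgeTheory
open Literature.AlgebraicGeometry.Motives

namespace Literature.AlgebraicGeometry.Milne1999

/-! ### §0 Plumbing (private): reassociation isogenies; composing character-preserving isomorphisms -/

section Plumbing

/-- `(X × Y) × Z ∼ (X × Z) × Y` (an isomorphism of abelian varieties: swap the last two factors). [cite: MumfordAV1970, §19] -/
private theorem isIsogenous_prod_prod_swap_right (X Y Z : AbelianVariety ℂ) :
    AbelianVariety.IsIsogenous ((X.prod Y).prod Z) ((X.prod Z).prod Y) := by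
  refine ⟨AbelianVariety.prodLift (AbelianVariety.prodLift (AbelianVariety.fst _ _ ≫ AbelianVariety.fst _ _) (AbelianVariety.snd _ _))
      (AbelianVariety.fst _ _ ≫ AbelianVariety.snd _ _),
    AbelianVariety.isIsogeny_of_comp_eq_of_comp_eq
      (h := AbelianVariety.prodLift (AbelianVariety.prodLift (AbelianVariety.fst _ _ ≫ AbelianVariety.fst _ _) (AbelianVariety.snd _ _))
        (AbelianVariety.fst _ _ ≫ AbelianVariety.snd _ _))
      (AbelianVariety.isIsogeny_id _) (AbelianVariety.isIsogeny_id _) ?_ ?_⟩ <;>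
  · refine AbelianVariety.prod_hom_ext (AbelianVariety.prod_hom_ext ?_ ?_) ?_ <;>
      simp only [Category.assoc, Category.id_comp, AbelianVariety.prodLift_fst, AbelianVariety.prodLift_snd,
        AbelianVariety.prodLift_fst_assoc]

/-- `X × Y ∼ Y × X` (the swap, an isomorphism). [cite: MumfordAV1970, §19] -/
private theorem isIsogenous_prod_comm' (X Y : AbelianVariety ℂ) : AbelianVariety.IsIsogenous (X.prod Y) (Y.prod X) := by
  refine ⟨AbelianVariety.prodLift (AbelianVariety.snd _ _) (AbelianVariety.fst _ _),
    AbelianVariety.isIsogeny_of_comp_eq_of_comp_eq (h := AbelianVariety.prodLift (AbelianVariety.snd _ _) (AbelianVariety.fst _ _))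
      (AbelianVariety.isIsogeny_id _) (AbelianVariety.isIsogeny_id _) ?_ ?_⟩ <;>
  · refine AbelianVariety.prod_hom_ext ?_ ?_ <;>
      simp only [Category.assoc, Category.id_comp, AbelianVariety.prodLift_fst, AbelianVariety.prodLift_snd]

/-- `X × (Y × Z) ∼ (X × Y) × Z` (reassociation, an isomorphism). [cite: MumfordAV1970, §19] -/
private theorem isIsogenous_prod_assoc_symm (X Y Z : AbelianVariety ℂ) :
    AbelianVariety.IsIsogenous (X.prod (Y.prod Z)) ((X.prod Y).prod Z) := by
  refine ⟨AbelianVariety.prodLift (AbelianVariety.prodLift (AbelianVariety.fst _ _) (AbelianVariety.snd _ _ ≫ AbelianVariety.fst _ _))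
      (AbelianVariety.snd _ _ ≫ AbelianVariety.snd _ _),
    AbelianVariety.isIsogeny_of_comp_eq_of_comp_eq
      (h := AbelianVariety.prodLift (AbelianVariety.fst _ _ ≫ AbelianVariety.fst _ _)
        (AbelianVariety.prodLift (AbelianVariety.fst _ _ ≫ AbelianVariety.snd _ _) (AbelianVariety.snd _ _)))
      (AbelianVariety.isIsogeny_id _) (AbelianVariety.isIsogeny_id _) ?_ ?_⟩
  · refine AbelianVariety.prod_hom_ext (AbelianVariety.prod_hom_ext ?_ ?_) ?_ <;>
      simp only [Category.assoc, Category.id_comp, AbelianVariety.prodLift_fst, AbelianVariety.prodLift_snd,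
        AbelianVariety.prodLift_snd_assoc]
  · refine AbelianVariety.prod_hom_ext ?_ (AbelianVariety.prod_hom_ext ?_ ?_) <;>
      simp only [Category.assoc, Category.id_comp, AbelianVariety.prodLift_fst, AbelianVariety.prodLift_snd,
        AbelianVariety.prodLift_fst_assoc]

/-- `(X × Y) × Z ∼ X × (Y × Z)` (reassociation, an isomorphism). [cite: MumfordAV1970, §19] -/
private theorem isIsogenous_prod_assoc' (X Y Z : AbelianVariety ℂ) :
    AbelianVariety.IsIsogenous ((X.prod Y).prod Z) (X.prod (Y.prod Z)) := by
  refine ⟨AbelianVariety.prodLift (AbelianVariety.fst _ _ ≫ AbelianVariety.fst _ _)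
      (AbelianVariety.prodLift (AbelianVariety.fst _ _ ≫ AbelianVariety.snd _ _) (AbelianVariety.snd _ _)),
    AbelianVariety.isIsogeny_of_comp_eq_of_comp_eq
      (h := AbelianVariety.prodLift (AbelianVariety.prodLift (AbelianVariety.fst _ _) (AbelianVariety.snd _ _ ≫ AbelianVariety.fst _ _))
        (AbelianVariety.snd _ _ ≫ AbelianVariety.snd _ _))
      (AbelianVariety.isIsogeny_id _) (AbelianVariety.isIsogeny_id _) ?_ ?_⟩
  · refine AbelianVariety.prod_hom_ext ?_ (AbelianVariety.prod_hom_ext ?_ ?_) <;>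
      simp only [Category.assoc, Category.id_comp, AbelianVariety.prodLift_fst, AbelianVariety.prodLift_snd,
        AbelianVariety.prodLift_fst_assoc]
  · refine AbelianVariety.prod_hom_ext (AbelianVariety.prod_hom_ext ?_ ?_) ?_ <;>
      simp only [Category.assoc, Category.id_comp, AbelianVariety.prodLift_fst, AbelianVariety.prodLift_snd,
        AbelianVariety.prodLift_snd_assoc]

/-- **Isogenous abelian varieties have isomorphic `(L, l)`**, in the direction of the isogeny and as the triple «iso, `ker l ↔ ker l`,
`w ↦ w`» used throughout this file (from the lane's explicit `exists_lefschetzGroup_mulEquiv_of_isIsogeny`, inverted).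
[cite: Milne1999LefschetzClasses, §4 p. 658 («L(A) depends only on the isogeny class of A»)] -/
private theorem mulEquiv_of_isIsogenous {A B : AbelianVariety ℂ} (h : AbelianVariety.IsIsogenous A B) :
    ∃ e : lefschetzGroup A.dim A.X ≃* lefschetzGroup B.dim B.X,
      (∀ g : lefschetzGroup A.dim A.X, (e g).1 ∈ specialLefschetzGroup B.dim B.X ↔ g.1 ∈ specialLefschetzGroup A.dim A.X) ∧
      ∀ c : ℂˣ, e ⟨weightCocharacter A.X c, weightCocharacter_mem_lefschetzGroup c⟩ =
        ⟨weightCocharacter B.X c, weightCocharacter_mem_lefschetzGroup c⟩ := by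
  obtain ⟨f, hf⟩ := h
  obtain ⟨e, -, hker, hw⟩ := exists_lefschetzGroup_mulEquiv_of_isIsogeny hf
  refine ⟨e.symm, fun g ↦ ?_, fun c ↦ ?_⟩
  · have k := hker (e.symm g)
    rw [MulEquiv.apply_symm_apply] at k
    exact k.symm
  · rw [MulEquiv.symm_apply_eq]
    exact (hw c).symm

/-- Composition of two «iso, `ker l ↔ ker l`, `w ↦ w`» triples. [folklore] -/
private theorem mulEquiv_trans {X Y Z : AbelianVariety ℂ}
    (h₁ : ∃ e : lefschetzGroup X.dim X.X ≃* lefschetzGroup Y.dim Y.X,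
      (∀ g : lefschetzGroup X.dim X.X, (e g).1 ∈ specialLefschetzGroup Y.dim Y.X ↔ g.1 ∈ specialLefschetzGroup X.dim X.X) ∧
      ∀ c : ℂˣ, e ⟨weightCocharacter X.X c, weightCocharacter_mem_lefschetzGroup c⟩ =
        ⟨weightCocharacter Y.X c, weightCocharacter_mem_lefschetzGroup c⟩)
    (h₂ : ∃ e : lefschetzGroup Y.dim Y.X ≃* lefschetzGroup Z.dim Z.X,
      (∀ g : lefschetzGroup Y.dim Y.X, (e g).1 ∈ specialLefschetzGroup Z.dim Z.X ↔ g.1 ∈ specialLefschetzGroup Y.dim Y.X) ∧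
      ∀ c : ℂˣ, e ⟨weightCocharacter Y.X c, weightCocharacter_mem_lefschetzGroup c⟩ =
        ⟨weightCocharacter Z.X c, weightCocharacter_mem_lefschetzGroup c⟩) :
    ∃ e : lefschetzGroup X.dim X.X ≃* lefschetzGroup Z.dim Z.X,
      (∀ g : lefschetzGroup X.dim X.X, (e g).1 ∈ specialLefschetzGroup Z.dim Z.X ↔ g.1 ∈ specialLefschetzGroup X.dim X.X) ∧
      ∀ c : ℂˣ, e ⟨weightCocharacter X.X c, weightCocharacter_mem_lefschetzGroup c⟩ =
        ⟨weightCocharacter Z.X c, weightCocharacter_mem_lefschetzGroup c⟩ := by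
  obtain ⟨e₁, k₁, w₁⟩ := h₁
  obtain ⟨e₂, k₂, w₂⟩ := h₂
  exact ⟨e₁.trans e₂, fun g ↦ (k₂ (e₁ g)).trans (k₁ g), fun c ↦ by rw [MulEquiv.trans_apply, w₁, w₂]⟩

/-- A «iso, `ker l ↔ ker l`» pair restricts to an isomorphism of the kernels of `l`. [cite: Milne1999LefschetzClasses, p. 659 (ker l = S)] -/
private theorem specialLefschetzGroup_mulEquiv_of {X Y : AbelianVariety ℂ} (e : lefschetzGroup X.dim X.X ≃* lefschetzGroup Y.dim Y.X)
    (he : ∀ g : lefschetzGroup X.dim X.X, (e g).1 ∈ specialLefschetzGroup Y.dim Y.X ↔ g.1 ∈ specialLefschetzGroup X.dim X.X) :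
    ∃ e' : specialLefschetzGroup X.dim X.X ≃* specialLefschetzGroup Y.dim Y.X,
      ∀ s : specialLefschetzGroup X.dim X.X, (e' s).1 = (e ⟨s.1, specialLefschetzGroup_le_lefschetzGroup s.2⟩).1 := by
  let ι₁ : specialLefschetzGroup X.dim X.X →* lefschetzGroup X.dim X.X := Subgroup.inclusion specialLefschetzGroup_le_lefschetzGroup
  let F : specialLefschetzGroup X.dim X.X →* specialLefschetzGroup Y.dim Y.X :=
    ((lefschetzGroup Y.dim Y.X).subtype.comp (e.toMonoidHom.comp ι₁)).codRestrict _ fun s ↦ (he _).2 s.2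
  have hF : ∀ s, (F s).1 = (e (ι₁ s)).1 := fun _ ↦ rfl
  refine ⟨MulEquiv.ofBijective F ⟨fun s t h ↦ ?_, fun t ↦ ?_⟩, fun s ↦ rfl⟩
  · have h1 : (e (ι₁ s)).1 = (e (ι₁ t)).1 := by rw [← hF, ← hF, h]
    exact Subgroup.inclusion_injective _ (e.injective (Subtype.ext h1))
  · set g := e.symm ⟨t.1, specialLefschetzGroup_le_lefschetzGroup t.2⟩ with hg
    have hgS : g.1 ∈ specialLefschetzGroup X.dim X.X := (he g).1 (by rw [hg, MulEquiv.apply_symm_apply]; exact t.2)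
    refine ⟨⟨g.1, hgS⟩, Subtype.ext ?_⟩
    rw [hF]
    have e1 : ι₁ ⟨g.1, hgS⟩ = g := Subtype.ext rfl
    rw [e1, hg, MulEquiv.apply_symm_apply]

end Plumbing

/-! ### §1 The passenger form: `(L(X × ⨁ᵢ Aᵢ), l) ≅ (L(X × ⨁ᵢ Aᵢ^{rᵢ+1}), l)` -/

section Passenger

/-- **`(L(X × ⨁ᵢ Aᵢ), l) ≅ (L(X × ⨁ᵢ Aᵢ^{rᵢ+1}), l)` FOR EVERY PASSENGER `X`, EVERY FINITE FAMILY `(Aᵢ)` AND ALL EXPONENTS** (Moonen–Zarhin §1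
«`Hg(X_1^{n_1} × ⋯ × X_r^{n_r}) = Hg(X_1 × ⋯ × X_r)`» for Milne's `(L, l)`, no hypothesis on the factors): a group isomorphism matching
the kernels of `l` and the weight cocharacters. Induction on the number of factors: split off `A₀` (`biproductSuccSplit`, an isogeny),
move it to the right (`X × (A₀ × T) ∼ (X × T) × A₀`), reduce its exponent with the passenger `X × T` (the prequel's two-factor
theorem with `m = 0`), move `A₀^{r₀+1}` into the passenger (`(X × T) × A₀^{r₀+1} ∼ (X × A₀^{r₀+1}) × T`), apply the induction
hypothesis to the tail `T = ⨁ᵢ A_{i+1}` with passenger `X × A₀^{r₀+1}`, reassociate and reassemble (`biproductSuccSplitInv`).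
[cite: MoonenZarhin1999LowDim, §1] [cite: Milne1999LefschetzClasses, §1 p. 643, Prop. 1.5 and Cor. 4.7 (p. 660)] -/
theorem exists_lefschetzGroup_prod_biproduct_mulEquiv_prod_biproduct_powSucc :
    ∀ {n : ℕ} (X : AbelianVariety ℂ) (A : Fin n → AbelianVariety ℂ) (r : Fin n → ℕ),
      ∃ e : lefschetzGroup (X.prod (⨁ A)).dim (X.prod (⨁ A)).X ≃*
          lefschetzGroup (X.prod (⨁ fun i ↦ (A i).powSucc (r i))).dim (X.prod (⨁ fun i ↦ (A i).powSucc (r i))).X,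
        (∀ g : lefschetzGroup (X.prod (⨁ A)).dim (X.prod (⨁ A)).X,
          (e g).1 ∈ specialLefschetzGroup (X.prod (⨁ fun i ↦ (A i).powSucc (r i))).dim (X.prod (⨁ fun i ↦ (A i).powSucc (r i))).X ↔
            g.1 ∈ specialLefschetzGroup (X.prod (⨁ A)).dim (X.prod (⨁ A)).X) ∧
        ∀ c : ℂˣ, e ⟨weightCocharacter (X.prod (⨁ A)).X c, weightCocharacter_mem_lefschetzGroup c⟩ =
          ⟨weightCocharacter (X.prod (⨁ fun i ↦ (A i).powSucc (r i))).X c, weightCocharacter_mem_lefschetzGroup c⟩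
  | 0, X, A, r => by
    -- over `Fin 0` the two families coincide
    suffices h : ∀ F F' : Fin 0 → AbelianVariety ℂ,
        ∃ e : lefschetzGroup (X.prod (⨁ F)).dim (X.prod (⨁ F)).X ≃* lefschetzGroup (X.prod (⨁ F')).dim (X.prod (⨁ F')).X,
          (∀ g : lefschetzGroup (X.prod (⨁ F)).dim (X.prod (⨁ F)).X,
            (e g).1 ∈ specialLefschetzGroup (X.prod (⨁ F')).dim (X.prod (⨁ F')).X ↔
              g.1 ∈ specialLefschetzGroup (X.prod (⨁ F)).dim (X.prod (⨁ F)).X) ∧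
          ∀ c : ℂˣ, e ⟨weightCocharacter (X.prod (⨁ F)).X c, weightCocharacter_mem_lefschetzGroup c⟩ =
            ⟨weightCocharacter (X.prod (⨁ F')).X c, weightCocharacter_mem_lefschetzGroup c⟩ from h _ _
    intro F F'
    obtain rfl : F = F' := funext fun i ↦ i.elim0
    exact ⟨MulEquiv.refl _, fun _ ↦ Iff.rfl, fun _ ↦ rfl⟩
  | n + 1, X, A, r => by
    -- `X × ⨁ A ∼ X × (A₀ × T) ∼ (X × T) × A₀`, `T = ⨁ᵢ A_{i+1}`
    have h01 : AbelianVariety.IsIsogenous (X.prod (⨁ A)) (X.prod ((A 0).prod (⨁ fun i : Fin n ↦ A i.succ))) :=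
      ⟨_, AbelianVariety.isIsogeny_prodMap (AbelianVariety.isIsogeny_id X) (isIsogeny_biproductSuccSplit A)⟩
    have h12 : AbelianVariety.IsIsogenous (X.prod ((A 0).prod (⨁ fun i : Fin n ↦ A i.succ)))
        ((X.prod (⨁ fun i : Fin n ↦ A i.succ)).prod (A 0)) :=
      (isIsogenous_prod_assoc_symm X (A 0) _).trans (isIsogenous_prod_prod_swap_right X (A 0) _)
    -- reduce the exponent of `A₀` with the passenger `X × T` (two-factor theorem, `m = 0`)
    obtain ⟨e23, -, k23, w23⟩ :=
      exists_lefschetzGroup_prod_mulEquiv_powSucc_prod_powSucc (X.prod (⨁ fun i : Fin n ↦ A i.succ)) (A 0) 0 (r 0)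
    -- `(X × T) × A₀^{r₀+1} ∼ (X × A₀^{r₀+1}) × T`
    have h34 : AbelianVariety.IsIsogenous (((X.prod (⨁ fun i : Fin n ↦ A i.succ)).powSucc 0).prod ((A 0).powSucc (r 0)))
        ((X.prod ((A 0).powSucc (r 0))).prod (⨁ fun i : Fin n ↦ A i.succ)) :=
      isIsogenous_prod_prod_swap_right X (⨁ fun i : Fin n ↦ A i.succ) ((A 0).powSucc (r 0))
    -- the induction hypothesis, passenger `X × A₀^{r₀+1}`, family `(A_{i+1})ᵢ`
    have hIH := exists_lefschetzGroup_prod_biproduct_mulEquiv_prod_biproduct_powSucc (X.prod ((A 0).powSucc (r 0)))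
      (fun i : Fin n ↦ A i.succ) (fun i ↦ r i.succ)
    -- `(X × A₀^{r₀+1}) × ⨁ᵢ A_{i+1}^{r_{i+1}+1} ∼ X × (A₀^{r₀+1} × ⨁ᵢ A_{i+1}^{r_{i+1}+1}) ∼ X × ⨁ᵢ Aᵢ^{rᵢ+1}`
    have h56 : AbelianVariety.IsIsogenous
        ((X.prod ((A 0).powSucc (r 0))).prod (⨁ fun i : Fin n ↦ (A i.succ).powSucc (r i.succ)))
        (X.prod (((A 0).powSucc (r 0)).prod (⨁ fun i : Fin n ↦ (A i.succ).powSucc (r i.succ)))) :=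
      isIsogenous_prod_assoc' X _ _
    have h67 : AbelianVariety.IsIsogenous
        (X.prod (((A 0).powSucc (r 0)).prod (⨁ fun i : Fin n ↦ (A i.succ).powSucc (r i.succ))))
        (X.prod (⨁ fun i ↦ (A i).powSucc (r i))) :=
      ⟨_, AbelianVariety.isIsogeny_prodMap (AbelianVariety.isIsogeny_id X)
        (isIsogeny_biproductSuccSplitInv (fun i ↦ (A i).powSucc (r i)))⟩
    exact mulEquiv_trans (mulEquiv_of_isIsogenous h01) (mulEquiv_trans (mulEquiv_of_isIsogenous h12)
      (mulEquiv_trans ⟨e23, k23, w23⟩ (mulEquiv_trans (mulEquiv_of_isIsogenous h34) (mulEquiv_trans hIH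
        (mulEquiv_trans (mulEquiv_of_isIsogenous h56) (mulEquiv_of_isIsogenous h67))))))

/-- **`ker l(X × ⨁ᵢ Aᵢ)(ℂ) ≅ ker l(X × ⨁ᵢ Aᵢ^{rᵢ+1})(ℂ)`** (Prop. 1.5 for arbitrary finite families with a passenger, exponents reduced to `1`).
[cite: Milne1999LefschetzClasses, Prop. 1.5 (p. 644) and p. 659] [cite: MoonenZarhin1999LowDim, §1] -/
theorem nonempty_specialLefschetzGroup_prod_biproduct_mulEquiv_prod_biproduct_powSucc {n : ℕ} (X : AbelianVariety ℂ)
    (A : Fin n → AbelianVariety ℂ) (r : Fin n → ℕ) :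
    Nonempty (specialLefschetzGroup (X.prod (⨁ A)).dim (X.prod (⨁ A)).X ≃*
      specialLefschetzGroup (X.prod (⨁ fun i ↦ (A i).powSucc (r i))).dim (X.prod (⨁ fun i ↦ (A i).powSucc (r i))).X) := by
  obtain ⟨e, he, -⟩ := exists_lefschetzGroup_prod_biproduct_mulEquiv_prod_biproduct_powSucc X A r
  obtain ⟨e', -⟩ := specialLefschetzGroup_mulEquiv_of e he
  exact ⟨e'⟩

end Passenger

/-! ### §2 No passenger: `(L(⨁ᵢ Aᵢ), l) ≅ (L(⨁ᵢ Aᵢ^{rᵢ+1}), l)`, powers with no dimension hypothesis, torus coordinates -/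

section NoPassenger

/-- **`(L(⨁ᵢ Aᵢ), l) ≅ (L(⨁ᵢ Aᵢ^{rᵢ+1}), l)` FOR EVERY FINITE FAMILY `A : Fin (n+1) → AbelianVariety ℂ` AND ALL EXPONENTS** — Moonen–Zarhin
§1, second sentence, for Milne's Lefschetz group with its character; Cor. 4.7 / Prop. 1.5 with the exponents reduced to `1` and NO
hypothesis on the factors. Split off `A₀` (`biproductSuccSplit`), §1 with passenger `A₀`, the two-factor theorem for
`A₀ × ⨁ᵢ A_{i+1}^{r_{i+1}+1}` (`n = 0`), and reassemble. [cite: MoonenZarhin1999LowDim, §1]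
[cite: Milne1999LefschetzClasses, §1 p. 643, Prop. 1.5 (p. 644) and Cor. 4.7 (p. 660)] -/
theorem exists_lefschetzGroup_biproduct_mulEquiv_biproduct_powSucc {n : ℕ} (A : Fin (n + 1) → AbelianVariety ℂ) (r : Fin (n + 1) → ℕ) :
    ∃ e : lefschetzGroup (⨁ A).dim (⨁ A).X ≃*
        lefschetzGroup (⨁ fun i ↦ (A i).powSucc (r i)).dim (⨁ fun i ↦ (A i).powSucc (r i)).X,
      (∀ g : lefschetzGroup (⨁ A).dim (⨁ A).X,
        (e g).1 ∈ specialLefschetzGroup (⨁ fun i ↦ (A i).powSucc (r i)).dim (⨁ fun i ↦ (A i).powSucc (r i)).X ↔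
          g.1 ∈ specialLefschetzGroup (⨁ A).dim (⨁ A).X) ∧
      ∀ c : ℂˣ, e ⟨weightCocharacter (⨁ A).X c, weightCocharacter_mem_lefschetzGroup c⟩ =
        ⟨weightCocharacter (⨁ fun i ↦ (A i).powSucc (r i)).X c, weightCocharacter_mem_lefschetzGroup c⟩ := by
  -- `⨁ A ∼ A₀ × T`
  have h01 : AbelianVariety.IsIsogenous (⨁ A) ((A 0).prod (⨁ fun i : Fin n ↦ A i.succ)) :=
    ⟨_, isIsogeny_biproductSuccSplit A⟩
  -- passenger `A₀`, family `(A_{i+1})ᵢ`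
  have h12 := exists_lefschetzGroup_prod_biproduct_mulEquiv_prod_biproduct_powSucc (A 0) (fun i : Fin n ↦ A i.succ)
    (fun i ↦ r i.succ)
  -- `A₀ × T' ↦ A₀^{r₀+1} × T'` (two-factor theorem, `n = 0`)
  obtain ⟨e23, -, k23, w23⟩ := exists_lefschetzGroup_prod_mulEquiv_powSucc_prod_powSucc (A 0)
    (⨁ fun i : Fin n ↦ (A i.succ).powSucc (r i.succ)) (r 0) 0
  -- reassemble
  have h34 : AbelianVariety.IsIsogenous
      (((A 0).powSucc (r 0)).prod ((⨁ fun i : Fin n ↦ (A i.succ).powSucc (r i.succ)).powSucc 0))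
      (⨁ fun i ↦ (A i).powSucc (r i)) :=
    ⟨_, isIsogeny_biproductSuccSplitInv (fun i ↦ (A i).powSucc (r i))⟩
  exact mulEquiv_trans (mulEquiv_of_isIsogenous h01) (mulEquiv_trans h12 (mulEquiv_trans ⟨e23, k23, w23⟩ (mulEquiv_of_isIsogenous h34)))

/-- **`ker l(⨁ᵢ Aᵢ)(ℂ) ≅ ker l(⨁ᵢ Aᵢ^{rᵢ+1})(ℂ)` EXPLICITLY ON `L`**: the restriction of the previous isomorphism (Prop. 1.5
«`S(A_1) × ⋯ × S(A_s) → S(A)`», exponents reduced to `1`, arbitrary factors). [cite: Milne1999LefschetzClasses, Prop. 1.5 (p. 644) and p. 659]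
[cite: MoonenZarhin1999LowDim, §1] -/
theorem exists_specialLefschetzGroup_biproduct_mulEquiv_biproduct_powSucc {n : ℕ} (A : Fin (n + 1) → AbelianVariety ℂ)
    (r : Fin (n + 1) → ℕ) :
    ∃ (e : lefschetzGroup (⨁ A).dim (⨁ A).X ≃* lefschetzGroup (⨁ fun i ↦ (A i).powSucc (r i)).dim (⨁ fun i ↦ (A i).powSucc (r i)).X)
      (e' : specialLefschetzGroup (⨁ A).dim (⨁ A).X ≃*
        specialLefschetzGroup (⨁ fun i ↦ (A i).powSucc (r i)).dim (⨁ fun i ↦ (A i).powSucc (r i)).X),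
      ∀ s : specialLefschetzGroup (⨁ A).dim (⨁ A).X, (e' s).1 = (e ⟨s.1, specialLefschetzGroup_le_lefschetzGroup s.2⟩).1 := by
  obtain ⟨e, he, -⟩ := exists_lefschetzGroup_biproduct_mulEquiv_biproduct_powSucc A r
  obtain ⟨e', he'⟩ := specialLefschetzGroup_mulEquiv_of e he
  exact ⟨e, e', he'⟩

/-- `L(⨁ᵢ Aᵢ^{rᵢ+1})(ℂ) ≅ L(⨁ᵢ Aᵢ)(ℂ)` as abstract groups, arbitrary factors. [cite: Milne1999LefschetzClasses, Cor. 4.7 (p. 660)]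
[cite: MoonenZarhin1999LowDim, §1] -/
theorem nonempty_lefschetzGroup_biproduct_powSucc_mulEquiv_biproduct {n : ℕ} (A : Fin (n + 1) → AbelianVariety ℂ)
    (r : Fin (n + 1) → ℕ) :
    Nonempty (lefschetzGroup (⨁ fun i ↦ (A i).powSucc (r i)).dim (⨁ fun i ↦ (A i).powSucc (r i)).X ≃* lefschetzGroup (⨁ A).dim (⨁ A).X) := by
  obtain ⟨e, -⟩ := exists_lefschetzGroup_biproduct_mulEquiv_biproduct_powSucc A r
  exact ⟨e.symm⟩

/-- `ker l(⨁ᵢ Aᵢ^{rᵢ+1})(ℂ) ≅ ker l(⨁ᵢ Aᵢ)(ℂ)` as abstract groups, arbitrary factors. [cite: Milne1999LefschetzClasses, Prop. 1.5 (p. 644)]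
[cite: MoonenZarhin1999LowDim, §1] -/
theorem nonempty_specialLefschetzGroup_biproduct_powSucc_mulEquiv_biproduct {n : ℕ} (A : Fin (n + 1) → AbelianVariety ℂ)
    (r : Fin (n + 1) → ℕ) :
    Nonempty (specialLefschetzGroup (⨁ fun i ↦ (A i).powSucc (r i)).dim (⨁ fun i ↦ (A i).powSucc (r i)).X ≃*
      specialLefschetzGroup (⨁ A).dim (⨁ A).X) := by
  obtain ⟨-, e', -⟩ := exists_specialLefschetzGroup_biproduct_mulEquiv_biproduct_powSucc A r
  exact ⟨e'.symm⟩

/-- **`(L(A), l) ≅ (L(A^{r+1}), l)` with NO dimension hypothesis** (the lane's `exists_lefschetzGroup_powSucc_mulEquiv` assumes `dim A ≥ 1`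
and gives the explicit `g₁ ↦ g₁^{⊕(r+1)}`; here through `A ≅ ⨁_{Fin 1} A` and §2, for every `A`). [cite: Milne1999LefschetzClasses, §1 p. 643, Prop. 1.5 and Cor. 4.7]
[cite: MoonenZarhin1999LowDim, §1] -/
theorem exists_lefschetzGroup_powSucc_mulEquiv' (A : AbelianVariety ℂ) (r : ℕ) :
    ∃ e : lefschetzGroup A.dim A.X ≃* lefschetzGroup (A.powSucc r).dim (A.powSucc r).X,
      (∀ g : lefschetzGroup A.dim A.X,
        (e g).1 ∈ specialLefschetzGroup (A.powSucc r).dim (A.powSucc r).X ↔ g.1 ∈ specialLefschetzGroup A.dim A.X) ∧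
      ∀ c : ℂˣ, e ⟨weightCocharacter A.X c, weightCocharacter_mem_lefschetzGroup c⟩ =
        ⟨weightCocharacter (A.powSucc r).X c, weightCocharacter_mem_lefschetzGroup c⟩ := by
  have h01 : AbelianVariety.IsIsogenous A (⨁ fun _ : Fin 1 ↦ A) := ⟨_, isIsogeny_biproduct_ι_fin_one (fun _ : Fin 1 ↦ A)⟩
  have h12 := exists_lefschetzGroup_biproduct_mulEquiv_biproduct_powSucc (fun _ : Fin 1 ↦ A) (fun _ ↦ r)
  have h23 : AbelianVariety.IsIsogenous (⨁ fun _ : Fin 1 ↦ A.powSucc r) (A.powSucc r) :=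
    ⟨_, isIsogeny_biproduct_π_fin_one (fun _ : Fin 1 ↦ A.powSucc r)⟩
  exact mulEquiv_trans (mulEquiv_of_isIsogenous h01) (mulEquiv_trans h12 (mulEquiv_of_isIsogenous h23))

/-- **Torus coordinates with character pass from `⨁ᵢ Aᵢ` to `⨁ᵢ Aᵢ^{rᵢ+1}`** (the `H1 ∧ H2` format of `LefschetzGroupTorusFiniteProducts`:
last coordinate `= 1` on `ker l`, `= c²` at `w(c)`), arbitrary factors. [cite: Milne1999LefschetzClasses, Cor. 4.7 (p. 660) and p. 659] -/
theorem exists_lefschetzGroup_biproduct_powSucc_mulEquiv_of_mulEquiv_biproduct {n : ℕ} (A : Fin (n + 1) → AbelianVariety ℂ)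
    (r : Fin (n + 1) → ℕ) {T : Type*} [Group T] (eA : lefschetzGroup (⨁ A).dim (⨁ A).X ≃* T × ℂˣ)
    (h1 : ∀ s : lefschetzGroup (⨁ A).dim (⨁ A).X, s.1 ∈ specialLefschetzGroup (⨁ A).dim (⨁ A).X → (eA s).2 = 1)
    (h2 : ∀ c : ℂˣ, (eA ⟨weightCocharacter (⨁ A).X c, weightCocharacter_mem_lefschetzGroup c⟩).2 = c ^ 2) :
    ∃ eP : lefschetzGroup (⨁ fun i ↦ (A i).powSucc (r i)).dim (⨁ fun i ↦ (A i).powSucc (r i)).X ≃* T × ℂˣ,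
      (∀ s : lefschetzGroup (⨁ fun i ↦ (A i).powSucc (r i)).dim (⨁ fun i ↦ (A i).powSucc (r i)).X,
        s.1 ∈ specialLefschetzGroup (⨁ fun i ↦ (A i).powSucc (r i)).dim (⨁ fun i ↦ (A i).powSucc (r i)).X → (eP s).2 = 1) ∧
      ∀ c : ℂˣ, (eP ⟨weightCocharacter (⨁ fun i ↦ (A i).powSucc (r i)).X c, weightCocharacter_mem_lefschetzGroup c⟩).2 = c ^ 2 := by
  obtain ⟨e, hker, hw⟩ := exists_lefschetzGroup_biproduct_mulEquiv_biproduct_powSucc A r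
  refine ⟨e.symm.trans eA, fun s hs ↦ ?_, fun c ↦ ?_⟩
  · rw [MulEquiv.trans_apply]
    refine h1 _ ((hker (e.symm s)).1 ?_)
    rw [MulEquiv.apply_symm_apply]
    exact hs
  · rw [MulEquiv.trans_apply, ← hw c, MulEquiv.symm_apply_apply, h2]

/-- **`(L(Z), l) ≅ (L(Y), l)` whenever `Z ∼ ⨁ᵢ Aᵢ` and `Y ∼ ⨁ᵢ Aᵢ^{rᵢ+1}`** (arbitrary factors; isogeny invariance on both sides).
[cite: Milne1999LefschetzClasses, §4 p. 658, Prop. 1.5 and Cor. 4.7] [cite: MoonenZarhin1999LowDim, §1] -/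
theorem exists_lefschetzGroup_mulEquiv_of_isIsogenous_biproduct_powSucc_of_isIsogenous_biproduct {n : ℕ}
    (A : Fin (n + 1) → AbelianVariety ℂ) (r : Fin (n + 1) → ℕ) {Y Z : AbelianVariety ℂ}
    (hZ : AbelianVariety.IsIsogenous Z (⨁ A)) (hY : AbelianVariety.IsIsogenous Y (⨁ fun i ↦ (A i).powSucc (r i))) :
    ∃ e : lefschetzGroup Z.dim Z.X ≃* lefschetzGroup Y.dim Y.X,
      (∀ g : lefschetzGroup Z.dim Z.X, (e g).1 ∈ specialLefschetzGroup Y.dim Y.X ↔ g.1 ∈ specialLefschetzGroup Z.dim Z.X) ∧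
      ∀ c : ℂˣ, e ⟨weightCocharacter Z.X c, weightCocharacter_mem_lefschetzGroup c⟩ =
        ⟨weightCocharacter Y.X c, weightCocharacter_mem_lefschetzGroup c⟩ := by
  obtain ⟨f, hf⟩ := hY
  obtain ⟨eY, -, hkerY, hwY⟩ := exists_lefschetzGroup_mulEquiv_of_isIsogeny hf
  exact mulEquiv_trans (mulEquiv_of_isIsogenous hZ)
    (mulEquiv_trans (exists_lefschetzGroup_biproduct_mulEquiv_biproduct_powSucc A r) ⟨eY, hkerY, hwY⟩)

/-- **`L(⨁ᵢ Aᵢ^{rᵢ+1})(ℂ)` is commutative iff `L(⨁ᵢ Aᵢ)(ℂ)` is** (transport along §2; with the lane's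
`LefschetzGroupCommutativeIffCMType` this reads «a product of powers has commutative Lefschetz group iff the product of the bases does»).
[cite: Milne1999LefschetzClasses, Cor. 4.7 (p. 660)] [cite: MoonenZarhin1999LowDim, §1] -/
theorem forall_mul_comm_lefschetzGroup_biproduct_powSucc_iff {n : ℕ} (A : Fin (n + 1) → AbelianVariety ℂ) (r : Fin (n + 1) → ℕ) :
    (∀ g h : lefschetzGroup (⨁ fun i ↦ (A i).powSucc (r i)).dim (⨁ fun i ↦ (A i).powSucc (r i)).X, g * h = h * g) ↔
      ∀ g h : lefschetzGroup (⨁ A).dim (⨁ A).X, g * h = h * g := by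
  obtain ⟨e, -⟩ := exists_lefschetzGroup_biproduct_mulEquiv_biproduct_powSucc A r
  refine ⟨fun H g h ↦ e.injective ?_, fun H g h ↦ e.symm.injective ?_⟩
  · rw [map_mul, map_mul, H]
  · rw [map_mul, map_mul, H]

end NoPassenger

/-! ### §3 Three factors, biproduct-free: `(L(A × B × C), l) ≅ (L(A^{a+1} × B^{b+1} × C^{c+1}), l)` -/

section ThreeFactors

/-- **`(L((A × B) × C), l) ≅ (L((A^{a+1} × B^{b+1}) × C^{c+1}), l)` for ARBITRARY `A`, `B`, `C`** (Moonen–Zarhin §1 for `r = 3` and Milne's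
`(L, l)`, in binary products, no biproducts): the two-factor theorem three times, each factor in turn moved to the right of a
passenger, with the reassociation / swap isogenies in between. [cite: MoonenZarhin1999LowDim, §1]
[cite: Milne1999LefschetzClasses, §1 p. 643, Prop. 1.5 and Cor. 4.7 (p. 660)] -/
theorem exists_lefschetzGroup_prod_prod_mulEquiv_powSucc_prod_powSucc_prod_powSucc (A B C : AbelianVariety ℂ) (a b c : ℕ) :
    ∃ e : lefschetzGroup ((A.prod B).prod C).dim ((A.prod B).prod C).X ≃*
        lefschetzGroup (((A.powSucc a).prod (B.powSucc b)).prod (C.powSucc c)).dim (((A.powSucc a).prod (B.powSucc b)).prod (C.powSucc c)).X,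
      (∀ g : lefschetzGroup ((A.prod B).prod C).dim ((A.prod B).prod C).X,
        (e g).1 ∈ specialLefschetzGroup (((A.powSucc a).prod (B.powSucc b)).prod (C.powSucc c)).dim
            (((A.powSucc a).prod (B.powSucc b)).prod (C.powSucc c)).X ↔
          g.1 ∈ specialLefschetzGroup ((A.prod B).prod C).dim ((A.prod B).prod C).X) ∧
      ∀ z : ℂˣ, e ⟨weightCocharacter ((A.prod B).prod C).X z, weightCocharacter_mem_lefschetzGroup z⟩ =
        ⟨weightCocharacter (((A.powSucc a).prod (B.powSucc b)).prod (C.powSucc c)).X z, weightCocharacter_mem_lefschetzGroup z⟩ := by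
  -- `C`: `(A × B) × C ↦ (A × B) × C^{c+1}`
  obtain ⟨e1, -, k1, w1⟩ := exists_lefschetzGroup_prod_mulEquiv_powSucc_prod_powSucc (A.prod B) C 0 c
  -- `B`: `(A × B) × C^{c+1} ∼ (A × C^{c+1}) × B ↦ (A × C^{c+1}) × B^{b+1} ∼ (A × B^{b+1}) × C^{c+1}`
  have h2 : AbelianVariety.IsIsogenous (((A.prod B).powSucc 0).prod (C.powSucc c)) ((A.prod (C.powSucc c)).prod B) :=
    isIsogenous_prod_prod_swap_right A B (C.powSucc c)
  obtain ⟨e3, -, k3, w3⟩ := exists_lefschetzGroup_prod_mulEquiv_powSucc_prod_powSucc (A.prod (C.powSucc c)) B 0 b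
  have h4 : AbelianVariety.IsIsogenous (((A.prod (C.powSucc c)).powSucc 0).prod (B.powSucc b)) ((A.prod (B.powSucc b)).prod (C.powSucc c)) :=
    isIsogenous_prod_prod_swap_right A (C.powSucc c) (B.powSucc b)
  -- `A`: `(A × B^{b+1}) × C^{c+1} ∼ (B^{b+1} × C^{c+1}) × A ↦ (B^{b+1} × C^{c+1}) × A^{a+1} ∼ (A^{a+1} × B^{b+1}) × C^{c+1}`
  have h5 : AbelianVariety.IsIsogenous ((A.prod (B.powSucc b)).prod (C.powSucc c)) (((B.powSucc b).prod (C.powSucc c)).prod A) :=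
    (isIsogenous_prod_assoc' A (B.powSucc b) (C.powSucc c)).trans (isIsogenous_prod_comm' A _)
  obtain ⟨e6, -, k6, w6⟩ := exists_lefschetzGroup_prod_mulEquiv_powSucc_prod_powSucc ((B.powSucc b).prod (C.powSucc c)) A 0 a
  have h7 : AbelianVariety.IsIsogenous ((((B.powSucc b).prod (C.powSucc c)).powSucc 0).prod (A.powSucc a))
      (((A.powSucc a).prod (B.powSucc b)).prod (C.powSucc c)) :=
    (isIsogenous_prod_comm' ((B.powSucc b).prod (C.powSucc c)) (A.powSucc a)).trans (isIsogenous_prod_assoc_symm (A.powSucc a) _ _)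
  exact mulEquiv_trans ⟨e1, k1, w1⟩ (mulEquiv_trans (mulEquiv_of_isIsogenous h2) (mulEquiv_trans ⟨e3, k3, w3⟩
    (mulEquiv_trans (mulEquiv_of_isIsogenous h4) (mulEquiv_trans (mulEquiv_of_isIsogenous h5) (mulEquiv_trans ⟨e6, k6, w6⟩
      (mulEquiv_of_isIsogenous h7))))))

/-- `L((A^{a+1} × B^{b+1}) × C^{c+1})(ℂ) ≅ L((A × B) × C)(ℂ)` as abstract groups, arbitrary `A`, `B`, `C`.
[cite: MoonenZarhin1999LowDim, §1] [cite: Milne1999LefschetzClasses, Cor. 4.7 (p. 660)] -/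
theorem nonempty_lefschetzGroup_powSucc_prod_powSucc_prod_powSucc_mulEquiv (A B C : AbelianVariety ℂ) (a b c : ℕ) :
    Nonempty (lefschetzGroup (((A.powSucc a).prod (B.powSucc b)).prod (C.powSucc c)).dim
        (((A.powSucc a).prod (B.powSucc b)).prod (C.powSucc c)).X ≃* lefschetzGroup ((A.prod B).prod C).dim ((A.prod B).prod C).X) := by
  obtain ⟨e, -⟩ := exists_lefschetzGroup_prod_prod_mulEquiv_powSucc_prod_powSucc_prod_powSucc A B C a b c
  exact ⟨e.symm⟩

/-- `ker l((A^{a+1} × B^{b+1}) × C^{c+1})(ℂ) ≅ ker l((A × B) × C)(ℂ)` as abstract groups, arbitrary `A`, `B`, `C` (Prop. 1.5, three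
factors, exponents reduced to `1`). [cite: Milne1999LefschetzClasses, Prop. 1.5 (p. 644)] [cite: MoonenZarhin1999LowDim, §1] -/
theorem nonempty_specialLefschetzGroup_powSucc_prod_powSucc_prod_powSucc_mulEquiv (A B C : AbelianVariety ℂ) (a b c : ℕ) :
    Nonempty (specialLefschetzGroup (((A.powSucc a).prod (B.powSucc b)).prod (C.powSucc c)).dim
        (((A.powSucc a).prod (B.powSucc b)).prod (C.powSucc c)).X ≃*
      specialLefschetzGroup ((A.prod B).prod C).dim ((A.prod B).prod C).X) := by
  obtain ⟨e, he, -⟩ := exists_lefschetzGroup_prod_prod_mulEquiv_powSucc_prod_powSucc_prod_powSucc A B C a b c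
  obtain ⟨e', -⟩ := specialLefschetzGroup_mulEquiv_of e he
  exact ⟨e'.symm⟩

end ThreeFactors

end Literature.AlgebraicGeometry.Milne1999
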